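import Literature.NumberTheory.Sieve.MontgomeryVaughan1975
import Literature.NumberTheory.Sieve.MontgomeryVaughan1975MinorArcs
import Literature.NumberTheory.Sieve.VinogradovExpSum
import HarnessLib

/-!
# Montgomery–Vaughan (1975): the two §3 named facts hold

Theorems only (no definitions, no named facts). Discharges, outright, two of the three named facts
of `Literature/NumberTheory/Sieve/MontgomeryVaughan1975.lean` (H. L. Montgomery, R. C. Vaughan,
*The exceptional set in Goldbach's problem*, Acta Arith. 27 (1975), 353–370
[MontgomeryVaughanActa1975]):

* `Literature.NumberTheory.Sieve.MontgomeryVaughan1975.vinogradov_expSum_bound_holds` — LEMMA 3.1 in the textbook form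
  of Nathanson, GTM 164, Theorem 8.5
  (`|∑_{p ≤ N} (log p) e(pα)| ≪ (N q^{-1/2} + N^{4/5} + N^{1/2} q^{1/2}) (log N)⁴` for
  `1 ≤ q ≤ N`, `(a, q) = 1`, `|α - a/q| ≤ q⁻²`): this is, word for word, the theorem
  `Literature.NumberTheory.Sieve.Vinogradov.vinogradov_primeExpSumLog_bound` proved (constant `C = 1552`, Vaughan's
  identity) in `Literature/NumberTheory/Sieve/VinogradovExpSum.lean` [Nathanson1996].
* `Literature.NumberTheory.Sieve.MontgomeryVaughan1975.minorArc_meanSquare_holds` — display (3.2), p. 356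
  (`∑_{n ≤ X} R₂(n)² ≪ X³ P⁻¹ (log X)³⁵`, `P = X^{6δ}`, `0 < δ ≤ δ₀`): by
  `minorArc_meanSquare_of_vinogradov` (Bessel's inequality, Parseval, Dirichlet's theorem and
  (3.3), `Literature/NumberTheory/Sieve/MontgomeryVaughan1975MinorArcs.lean`) and the previous
  item.

After this file, Montgomery–Vaughan's Theorem 1
(`Literature.NumberTheory.Sieve.goldbachExceptionalCount_isBigO_rpow`, parity.S15: `E(x) ≪ x^{1-δ}`) rests on the
single named fact `majorArc_lowerBound` ((8.3), the major arcs: log-free zero-density estimates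
and the Deuring–Heilbronn phenomenon): `majorArc_lowerBound → goldbachExceptionalCount_isBigO_rpow`
is `Literature.Parity.goldbachExceptionalCount_isBigO_rpow_of_mv83 vinogradov_expSum_bound_holds`, and is
already in the tree as `Literature.NumberTheory.Sieve.goldbachExceptionalCount_isBigO_rpow_of_majorArc_mv`
(`Literature/NumberTheory/Sieve/LuGoldbachExceptionalSetProofs.lean`, by a second assembly).
-/

noncomputable section

namespace Literature.NumberTheory.Sieve.MontgomeryVaughan1975

/-- **Lemma 3.1 of Montgomery–Vaughan 1975 holds** (Vinogradov's estimate in Vaughan's form,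
Nathanson, GTM 164, Theorem 8.5, p. 220): the named fact `vinogradov_expSum_bound` is the theorem
`Literature.NumberTheory.Sieve.Vinogradov.vinogradov_primeExpSumLog_bound` (same statement, `C = 1552`).
[cite: Nathanson1996, Theorem 8.5, p. 220] -/
theorem vinogradov_expSum_bound_holds : vinogradov_expSum_bound :=
  Literature.NumberTheory.Sieve.Vinogradov.vinogradov_primeExpSumLog_bound

/-- **(3.2) of Montgomery–Vaughan 1975 holds**: the minor-arc mean square
`∑_{n ≤ X} R₂(n)² ≤ C X³ P⁻¹ (log X)³⁵` (`P = X^{6δ}`, `Q = X^{1-6δ}`, all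
`0 < δ ≤ δ₀ = 1/24`, `X ≥ 4`), unconditionally: `minorArc_meanSquare_of_vinogradov` (§3,
pp. 355–356: Bessel, Parseval, Dirichlet, (3.3)) applied to `vinogradov_expSum_bound_holds`.
[cite: MontgomeryVaughanActa1975, §3 (3.2), p. 356] -/
theorem minorArc_meanSquare_holds : minorArc_meanSquare :=
  minorArc_meanSquare_of_vinogradov vinogradov_expSum_bound_holds

end Literature.NumberTheory.Sieve.MontgomeryVaughan1975
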